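import Summits.ValiantsHypothesis.ValiantsHypothesis.Theorems.GrenetZeonDualUnipotentThreeHalvesHeavyTopBand
import Summits.ValiantsHypothesis.ValiantsHypothesis.Theorems.DualUnipotentThreeHalves.Negative.HeavyTopInstThreeFive
import Literature.LinearAlgebra.Matrix.GerstenhaberNilpotentSubspaceEquality
import Literature.LinearAlgebra.Matrix.GerstenhaberNilpotentSubspaceEqualityProof

/-!
# `GrenetZeon.DualUnipotentThreeHalves` (stmt-ValiantsHypothesis-24318) — line «radical_split» §8 (R227 outcome C):
# THE FIRST OPEN INSTANCE OF R2 IS GERSTENHABER'S EQUALITY CASE AT `4 × 4` — `HeavyTopInst 3 4 ↔ SqZeroInSix` — and the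
# `n = 3` column of the instance table

Port (val-lit merged desk, b71 (B) port pool; porter val-port-1 g2; text = val-idea-9 g4's §8, VERBATIM, credited) of the
`(3,4)` sub-sections of `Cruxes/DualUnipotentThreeHalves/Lines/radical_split.lean` @749d8538785a §8, over `…WordDefs`
(`HeavyTopInst`, `SqZeroInSix`, `linPencil`, …), `…WordFlagPencil` (duality + word toolkit), `…HeavyTopBand` (tops nilpotent,
Gerstenhaber bound, kernel triviality, the band) and the Negative file `…Negative.HeavyTopInstThreeFive` (`(3,5)` FALSE).

* `heavyTopInst_three_four_of_sqZeroInSix : SqZeroInSix → HeavyTopInst 3 4` — with `≤ 5` tops the kernel works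
  (`5 + 3 < 9`); with `6` tops take `K = N_lin⁻¹(W)` for a `4`-dimensional square-zero `W` inside the top space:
  `dim K = 4 + 3 = 7 > (1+1)·3`, and every pair `(N(x), N_lin(v))`, `v ∈ K`, is tame with budget `1`.
* `sqZeroInSix_of_heavyTopInst_three_four` — conversely, realise a `6`-dimensional nilpotent `V ≤ M₄(ℂ)` as the top space of
  a linear pencil (`linPencil`, `linPencil_pow_eq_zero` via `pow_eq_zero_of_isNilpotent_matrix` = Cayley–Hamilton);
  flag-cheapness forces budget `1`, `dim K ≥ 7`, square-zero tops on `K`, `dim N_lin(K) ≥ 4`.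
* ★ `heavyTopInst_three_four_iff : HeavyTopInst 3 4 ↔ SqZeroInSix` — `SqZeroInSix` («every `6`-dimensional nilpotent subspace
  of `M₄(ℂ)` contains a `4`-dimensional square-zero subspace») is GERSTENHABER'S EQUALITY CASE at `m = 4` (such a space is
  conjugate to `𝔫₄ ⊇ span{E₁₃, E₁₄, E₂₃, E₂₄}`), TRUE IN PRINT [Gerstenhaber 1958, Thm 2; de Seguins Pazzis 2013, Thm 1] and NOT
  yet in the tree (the Literature typing/proof is val-lit's P-iii; when it lands, `HeavyTopInst 3 4` follows by `.mpr`).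
* `instanceTable_n3` — the `n = 3` column as far as the kernel reaches: `m ≤ 3` TRUE (band), `m = 4 ⟺ SqZeroInSix`,
  `m = 5` FALSE (`not_heavyTopInst_three_five`), `m ≥ 6` inadmissible for `C₀ = 1`.

Honest framing.  Helper lemmas (`--supports stmt-ValiantsHypothesis-24318 --as helper`): an exact kernel-checked REDUCTION of
ONE instance of R2 to a published theorem, not a proof of it; R2 `HeavyTopLaw`, S3b, the crux `DualUnipotentThreeHalves`, rung
8062 and `VP ≠ VNP` are untouched / NOT proved.  [this line's workfile; Gerstenhaber 1958; de Seguins Pazzis, LAA 438 (2013)]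
-/

-- `Summit.ValiantsHypothesis.ValiantsHypothesis.…` repeats a component by the D-0017 layout
-- (single-conjunct summit), which the `dupNamespace` linter flags; the name is mandated.
set_option linter.dupNamespace false

noncomputable section

namespace Summit.ValiantsHypothesis.ValiantsHypothesis.Theorems.GrenetZeon.RadicalSplit

open MvPolynomial Matrix
open scoped BigOperators
open Summit.ValiantsHypothesis.ValiantsHypothesis.Cruxes.TwoDimCoefficients.DimTwoCases (AffMat IsAffine)

variable {m : ℕ}

/-! ## `SqZeroInSix → HeavyTopInst 3 4` -/

/-- **THE FIRST OPEN INSTANCE, REDUCED** (R227): `SqZeroInSix → HeavyTopInst 3 4`.  With `≤ 5` tops the kernel works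
(`5 + 3 < 9`); with `6` tops take `K = N_lin⁻¹(W)` for a `4`-dimensional square-zero `W` inside the top space:
`dim K = 4 + 3 = 7 > (1+1)·3` and every pair `(N(x), N_lin(v))`, `v ∈ K`, is tame with budget `1`. [this file] -/
theorem heavyTopInst_three_four_of_sqZeroInSix (hG : SqZeroInSix) : HeavyTopInst 3 4 := by
  intro N hN hnil _
  obtain ⟨T, hT⟩ := exists_topMap_linPart N hN
  have hle := finrank_range_top_le_choose_two N hN hnil T hT
  have h46 : (4 : ℕ).choose 2 = 6 := by decide
  by_cases h5 : Module.finrank ℂ (LinearMap.range T) ≤ 5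
  · exact flagCheap_of_finrank_range_lt N hN T hT (by omega)
  have h6 : Module.finrank ℂ (LinearMap.range T) = 6 := by omega
  have hnilp : ∀ A ∈ LinearMap.range T, IsNilpotent A := by
    intro A hA
    obtain ⟨v, rfl⟩ := LinearMap.mem_range.1 hA
    exact ⟨4, by rw [hT]; exact linPart_pow_eq_zero N hN hnil v⟩
  obtain ⟨W, hWV, hW4, hWsq⟩ := hG (LinearMap.range T) hnilp h6
  rw [flagCheap_iff_wordTame N hN]
  refine ⟨W.comap T, 1, ?_, fun x v hv => ?_⟩
  · have hrn := LinearMap.finrank_range_add_finrank_ker T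
    have hV : Module.finrank ℂ (Fin 3 × Fin 3 → ℂ) = 9 := by
      simp [Module.finrank_fintype_fun_eq_card]
    have hrn' := LinearMap.finrank_range_add_finrank_ker (T.domRestrict (W.comap T))
    rw [LinearMap.range_domRestrict, Submodule.map_comap_eq_self hWV, LinearMap.ker_domRestrict] at hrn'
    have hkerle : LinearMap.ker T ≤ W.comap T := fun u hu => by
      rw [LinearMap.mem_ker] at hu
      rw [Submodule.mem_comap, hu]
      exact W.zero_mem
    rw [(Submodule.comapSubtypeEquivOfLe hkerle).finrank_eq] at hrn'
    omega
  · rw [Submodule.mem_comap] at hv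
    have hsq : linPart N v * linPart N v = 0 := by rw [← hT v]; exact hWsq _ hv
    exact wordTame_of_sq_eq_zero (by norm_num) _ _ hsq

/-! ## The converse: `HeavyTopInst 3 4` is EXACTLY `SqZeroInSix` -/

/-- Entries of the linear pencil. -/
theorem linPencil_apply {n : ℕ} (B : Fin n × Fin n → Matrix (Fin m) (Fin m) ℂ) (i j : Fin m) :
    linPencil B i j = ∑ c, MvPolynomial.X c * MvPolynomial.C (B c i j) := by
  simp [linPencil, Matrix.sum_apply]

/-- A linear pencil is affine. -/
theorem isAffine_linPencil {n : ℕ} (B : Fin n × Fin n → Matrix (Fin m) (Fin m) ℂ) : IsAffine (linPencil B) := by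
  intro i j
  rw [linPencil_apply]
  refine MvPolynomial.totalDegree_finsetSum_le fun c _ => ?_
  refine (MvPolynomial.totalDegree_mul _ _).trans ?_
  simp [MvPolynomial.totalDegree_X]

/-- Values of the linear pencil: `N(x) = Σ_c x_c • B_c`. -/
theorem linPencil_map_eval {n : ℕ} (B : Fin n × Fin n → Matrix (Fin m) (Fin m) ℂ) (x : Fin n × Fin n → ℂ) :
    (linPencil B).map (MvPolynomial.eval x) = ∑ c, x c • B c := by
  ext i j
  simp [linPencil_apply, Matrix.sum_apply]

/-- Tops of the linear pencil: `N_lin(v) = Σ_c v_c • B_c`. -/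
theorem linPart_linPencil {n : ℕ} (B : Fin n × Fin n → Matrix (Fin m) (Fin m) ℂ) (v : Fin n × Fin n → ℂ) :
    linPart (linPencil B) v = ∑ c, v c • B c := by
  unfold linPart
  rw [linPencil_map_eval, linPencil_map_eval]
  simp

/-- A nilpotent `m × m` matrix has `A^m = 0` (Cayley–Hamilton with `charpoly = X^m`). [Mathlib] -/
theorem pow_eq_zero_of_isNilpotent_matrix (A : Matrix (Fin m) (Fin m) ℂ) (hA : IsNilpotent A) : A ^ m = 0 := by
  have h1 := Matrix.isNilpotent_charpoly_sub_pow_of_isNilpotent hA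
  have h2 : A.charpoly = Polynomial.X ^ m := by
    have := h1.eq_zero
    rw [sub_eq_zero] at this
    simpa using this
  have h3 := Matrix.aeval_self_charpoly A
  rwa [h2, map_pow, Polynomial.aeval_X] at h3

/-- A linear pencil all of whose values satisfy `(·)^m = 0` is a nilpotent polynomial matrix (polynomial identity over `ℂ`). -/
theorem linPencil_pow_eq_zero {n : ℕ} (B : Fin n × Fin n → Matrix (Fin m) (Fin m) ℂ)
    (hB : ∀ x : Fin n × Fin n → ℂ, (∑ c, x c • B c) ^ m = 0) : linPencil B ^ m = 0 := by
  refine Matrix.ext fun i j => ?_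
  apply MvPolynomial.funext
  intro x
  have h := congr_fun (congr_fun (hB x) i) j
  rw [← linPencil_map_eval, ← Matrix.map_pow] at h
  simpa [Matrix.map_apply] using h

/-- **Conversely `HeavyTopInst 3 4 → SqZeroInSix`**: realise a `6`-dimensional nilpotent `V ≤ M₄(ℂ)` as the top space of the
linear pencil `x ↦ φ(x)` for a linear surjection `φ : ℂ^{3×3} ↠ V`; flag-cheapness gives a `K` with `(k+1)·3 < dim K ≤ 9`, so
`k ≤ 1`; the tops on `K` have index `≤ k+1` (`pow_eq_zero_of_wordTame`); `k = 0` would put `K` (dim `≥ 4`) inside the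
`3`-dimensional kernel, so `k = 1`, `dim K ≥ 7`, the tops on `K` are square-zero, and `W = N_lin(K)` has `dim ≥ 7 − 3 = 4`.
So the first open instance of R2 IS Gerstenhaber's equality case at `m = 4`, no less. [this file] -/
theorem sqZeroInSix_of_heavyTopInst_three_four (h : HeavyTopInst 3 4) : SqZeroInSix := by
  intro V hV hV6
  classical
  let b := Module.finBasisOfFinrankEq ℂ V hV6
  let ι : Fin 6 → Fin 3 × Fin 3 := fun i => finProdFinEquiv.symm (Fin.castLE (by norm_num) i)
  have hι : Function.Injective ι := finProdFinEquiv.symm.injective.comp (Fin.castLE_injective _)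
  let φ : (Fin 3 × Fin 3 → ℂ) →ₗ[ℂ] V := b.equivFun.symm.toLinearMap ∘ₗ LinearMap.funLeft ℂ ℂ ι
  have hφ : Function.Surjective φ :=
    b.equivFun.symm.surjective.comp (LinearMap.funLeft_surjective_of_injective ℂ ℂ ι hι)
  let B : Fin 3 × Fin 3 → Matrix (Fin 4) (Fin 4) ℂ := fun c => ((φ fun j => if c = j then 1 else 0 : V) : Matrix (Fin 4) (Fin 4) ℂ)
  have hBdef : ∀ c, B c = ((φ fun j => if c = j then 1 else 0 : V) : Matrix (Fin 4) (Fin 4) ℂ) := fun c => rfl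
  have hsum : ∀ v : Fin 3 × Fin 3 → ℂ, (∑ c, v c • B c) = ((φ v : V) : Matrix (Fin 4) (Fin 4) ℂ) := by
    intro v
    rw [LinearMap.pi_apply_eq_sum_univ φ v]
    simp only [hBdef, Submodule.coe_sum, Submodule.coe_smul]
  set N : AffMat 3 4 := linPencil B with hNdef
  have hN : IsAffine N := isAffine_linPencil B
  have hnil : N ^ 4 = 0 := by
    refine linPencil_pow_eq_zero B fun x => ?_
    rw [hsum]
    exact pow_eq_zero_of_isNilpotent_matrix _ (hV _ (φ x).2)
  have hV9 : Module.finrank ℂ (Fin 3 × Fin 3 → ℂ) = 9 := by simp [Module.finrank_fintype_fun_eq_card]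
  have hH : ∀ K : Submodule ℂ (Fin 3 × Fin 3 → ℂ), RadOrth 3 4 N K →
      Module.finrank ℂ K ≤ 16 * 4 * Nat.sqrt 3 + 16 * 3 := by
    intro K _
    have h1 := Submodule.finrank_le K
    omega
  have hFC := h N hN hnil hH
  rw [flagCheap_iff_wordTame N hN] at hFC
  obtain ⟨K, k, hdim, hW⟩ := hFC
  have hKle : Module.finrank ℂ K ≤ 9 := by
    have h1 := Submodule.finrank_le K
    omega
  have hk1 : k ≤ 1 := by
    by_contra hk
    have : 3 * 3 ≤ (k + 1) * 3 := Nat.mul_le_mul_right 3 (by omega)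
    omega
  obtain ⟨T, hT⟩ := exists_topMap_linPart N hN
  have hTφ : ∀ v, T v = ((φ v : V) : Matrix (Fin 4) (Fin 4) ℂ) := fun v => by
    rw [hT, hNdef, linPart_linPencil]
    exact hsum v
  have hTV : ∀ v, T v ∈ V := fun v => by rw [hTφ]; exact (φ v).2
  have hVle : V ≤ LinearMap.range T := fun A hA => by
    obtain ⟨u, hu⟩ := hφ ⟨A, hA⟩
    exact LinearMap.mem_range.2 ⟨u, by rw [hTφ, hu]⟩
  have hker : Module.finrank ℂ (LinearMap.ker T) ≤ 3 := by
    have hrn := LinearMap.finrank_range_add_finrank_ker T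
    have := Submodule.finrank_mono hVle
    omega
  have hpow : ∀ v ∈ K, T v ^ (k + 1) = 0 := fun v hv => by
    rw [hT]
    exact pow_eq_zero_of_wordTame (by omega) _ _ (hW 0 v hv)
  have hk0 : k ≠ 0 := by
    rintro rfl
    have hKker : K ≤ LinearMap.ker T := fun v hv => by
      rw [LinearMap.mem_ker]
      simpa using hpow v hv
    have := Submodule.finrank_mono hKker
    omega
  obtain rfl : k = 1 := by omega
  refine ⟨K.map T, fun Q hQ => ?_, ?_, fun Q hQ => ?_⟩
  · obtain ⟨v, -, rfl⟩ := Submodule.mem_map.1 hQ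
    exact hTV v
  · have hrn' := LinearMap.finrank_range_add_finrank_ker (T.domRestrict K)
    rw [LinearMap.range_domRestrict, LinearMap.ker_domRestrict] at hrn'
    have hle : Module.finrank ℂ ((LinearMap.ker T).comap K.subtype) ≤ Module.finrank ℂ (LinearMap.ker T) := by
      rw [← Submodule.finrank_map_subtype_eq K ((LinearMap.ker T).comap K.subtype)]
      exact Submodule.finrank_mono (Submodule.map_comap_le _ _)
    omega
  · obtain ⟨v, hv, rfl⟩ := Submodule.mem_map.1 hQ
    simpa [pow_succ] using hpow v hv

/-- **R227, final form: the first open instance of R2 is Gerstenhaber's equality case at `m = 4`.** -/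
theorem heavyTopInst_three_four_iff : HeavyTopInst 3 4 ↔ SqZeroInSix :=
  ⟨sqZeroInSix_of_heavyTopInst_three_four, heavyTopInst_three_four_of_sqZeroInSix⟩

/-! ## The `n = 3` column of the instance table -/

/-- **The `n = 3` column of R2's instance table, as far as the kernel knows it**: `m ≤ 3` true, `m = 4` ⟺ `SqZeroInSix`
(Gerstenhaber's equality case, true in print), `m = 5` false, `m ≥ 6` inadmissible for `C₀ = 1`. -/
theorem instanceTable_n3 :
    (∀ m ≤ 3, HeavyTopInst 3 m) ∧ (HeavyTopInst 3 4 ↔ SqZeroInSix) ∧ ¬ HeavyTopInst 3 5 ∧ ∀ m ≥ 6, ¬ (1 * m ^ 2 < 3 ^ 3) :=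
  ⟨fun m hm => heavyTopInst_of_le hm (by norm_num), heavyTopInst_three_four_iff, not_heavyTopInst_three_five,
    fun m hm h => by nlinarith⟩

/-! ## The `(3,4)` instance from the Literature fact (appended, val-port-1 g2, after ✓ p633708 val-lit-p11 g5)

`SqZeroInSix` is the `K = ℂ` instance of val-lit-p11 g5's PROVED reduction
`Literature.LinearAlgebra.Matrix.GerstenhaberNilpotentSubspace.exists_sqZero_of_equality_four` of the NAMED FACT
`deSeguinsPazzis2013_equality` (Gerstenhaber's theorem, case of equality; [dSP13] Thm 1 — typed, its discharge is
val-lit-p9 g4's `…EqualityProof` file).  So, CONDITIONALLY on that named fact, the first open format of R2 holds;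
the unconditional `HeavyTopInst 3 4` follows by the same two lines once `deSeguinsPazzis2013_equality_holds` lands. -/

/-- `SqZeroInSix` from Gerstenhaber's equality case (named Literature fact, as a HYPOTHESIS).
[cite: deSeguinsPazzis2013Gerstenhaber, Theorem 1 (consequence, n = 4)] -/
theorem sqZeroInSix_of_equality
    (h : Literature.LinearAlgebra.Matrix.GerstenhaberNilpotentSubspace.deSeguinsPazzis2013_equality) : SqZeroInSix :=
  fun V hV h6 =>
    Literature.LinearAlgebra.Matrix.GerstenhaberNilpotentSubspace.exists_sqZero_of_equality_four h V hV h6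

/-- **The first open format of R2, CONDITIONALLY on Gerstenhaber's equality case**:
`deSeguinsPazzis2013_equality → HeavyTopInst 3 4`.  (Conditional result: the hypothesis is a typed, published, not-yet-
discharged Literature fact; nothing about R2 `HeavyTopLaw` / 24318 follows.) -/
theorem heavyTopInst_three_four_of_equality
    (h : Literature.LinearAlgebra.Matrix.GerstenhaberNilpotentSubspace.deSeguinsPazzis2013_equality) : HeavyTopInst 3 4 :=
  heavyTopInst_three_four_iff.mpr (sqZeroInSix_of_equality h)

/-! ## R227 outcome C, SETTLED: `HeavyTopInst 3 4` holds (appended, val-port-1 g2, after ✓ p636258 val-lit-p9 g4)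

Gerstenhaber's equality case is now a THEOREM of the tree
(`Literature.LinearAlgebra.Matrix.GerstenhaberNilpotentSubspace.deSeguinsPazzis2013_equality_holds`, val-lit-p9 g4, [dSP13] §4 as
printed, every field, every `n`), so the first format of R2 outside the quadratic band is decided TRUE in kernel:
the `n = 3` column of the instance table is COMPLETE — `m ≤ 4` TRUE, `m = 5` FALSE, `m ≥ 6` inadmissible for `C₀ = 1`.
Honest: ONE instance of R2 (the law quantifies `∃ C₀ n₀, ∀ n ≥ n₀, …`); nothing about `HeavyTopLaw` / 24318 follows. -/

/-- ★ **`HeavyTopInst 3 4`** — every affine nilpotent `4 × 4` pencil over `ℂ^{3×3}` (heavy-top or not: the hypothesis is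
automatic at `n = 3`) is flag-cheap.  [this line's §8 reduction + Gerstenhaber 1958 / de Seguins Pazzis 2013 Thm 1, equality
case, via `deSeguinsPazzis2013_equality_holds` (val-lit-p9 g4)] -/
theorem heavyTopInst_three_four : HeavyTopInst 3 4 :=
  heavyTopInst_three_four_of_equality
    Literature.LinearAlgebra.Matrix.GerstenhaberNilpotentSubspace.deSeguinsPazzis2013_equality_holds

/-- `SqZeroInSix` holds (Gerstenhaber's equality case at `4 × 4`, `K = ℂ`). -/
theorem sqZeroInSix : SqZeroInSix :=
  sqZeroInSix_of_equality Literature.LinearAlgebra.Matrix.GerstenhaberNilpotentSubspace.deSeguinsPazzis2013_equality_holds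

/-- **The `n = 3` column of R2's instance table, complete**: `m ≤ 4` TRUE, `m = 5` FALSE, `m ≥ 6` inadmissible for `C₀ = 1`. -/
theorem instanceTable_n3_complete :
    (∀ m ≤ 4, HeavyTopInst 3 m) ∧ ¬ HeavyTopInst 3 5 ∧ ∀ m ≥ 6, ¬ (1 * m ^ 2 < 3 ^ 3) := by
  refine ⟨fun m hm => ?_, not_heavyTopInst_three_five, fun m hm h => by nlinarith⟩
  rcases Nat.lt_or_ge m 4 with h | h
  · exact heavyTopInst_of_le (by omega) (by norm_num)
  · obtain rfl : m = 4 := le_antisymm hm h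
    exact heavyTopInst_three_four

end Summit.ValiantsHypothesis.ValiantsHypothesis.Theorems.GrenetZeon.RadicalSplit

end
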